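/-
Copyright (c) 2026. All rights reserved.
Released under Apache 2.0 license as described in the file LICENSE.
Authors: abc-iut cell, seat abc-iut-L4-t15 (gen 6).
-/
import Literature.GroupTheory.ProfiniteCommutatorWidthPByMetacyclic
import Literature.GroupTheory.FGTorsionFiniteIndex
import Literature.GroupTheory.ProPStronglyComplete

/-!
# Openness of `⁅H, G⁆ · Hⁿ` in profinite groups of `p`-by-metacyclic shape (N–S-free)

Setting as in `Literature/GroupTheory/ProfiniteCommutatorWidthPByMetacyclic.lean` (profinite `G`,
closed normal pro-`p` subgroup `P`, elements `t, s`, topologically generating slots `g` with the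
`(S1)–(S3)` structure; in addition `P` is assumed closed).  For a normal subgroup `H ≤ P` which is OPEN
IN `P` (`V₀ ∩ P ≤ H` for some open subgroup `V₀`) and `n ≠ 0` we prove

* `exists_isOpen_inf_le_commutator_sup_pow_of_profinite` —
  `∃ V open, V ∩ H ≤ ⁅H, G⁆ ⊔ ⟨xⁿ : x ∈ H⟩`,

i.e. the abstract subgroup `⁅H, G⁆ · Hⁿ` is open in `H`.  This is hypothesis `(c'')` of
`Literature.GroupTheory.isOpen_of_finiteIndex_of_proP_normal` (`StronglyCompleteWildReduction.lean`,
seat abc-iut-w5-d006) for the pair `(P' = H, U = G)`, obtained WITHOUT the theorem of Nikolov–Segal: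
closedness is `isClosed_commutator_sup_pow_of_profinite`; finiteness of the index is elementary —
writing `A = ⁅H,G⁆·Hⁿ`, every `G`-conjugacy class of an element of `P` meets only finitely many cosets of
`A` (the stabiliser `U₀ = {w | ⁅w, r⁆ ∈ H}` is open, `w ↦ ⁅w, r⁆` is a homomorphism `U₀ → H/A` into an
abelian group of exponent `n`, with finitely generated hence finite image), so the closed normal
subgroup `P` topologically generated by finitely many conjugacy classes satisfies `[P : A] < ∞`
(a finitely generated group with a finite-index abelian subgroup of finite exponent is finite).

Mathlib-only vocabulary, no definitions, no instances (cell abc-iut, GAP-LEDGER G-L3d2g2-1).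
-/

namespace Literature.GroupTheory

open scoped commutatorElement Pointwise

universe u

variable {G : Type u} [Group G] [TopologicalSpace G] [IsTopologicalGroup G] [CompactSpace G]
  [T2Space G] [TotallyDisconnectedSpace G]

/-! ### Finitely many cosets of a closed subgroup meet a conjugacy class -/

omit [T2Space G] [TotallyDisconnectedSpace G] in
/-- **Conjugacy classes meet finitely many cosets.**  Let `G` be profinite and topologically finitely
generated, `A ≤ H ≤ P` subgroups with `P, H, A` normal, `A` closed, `H` open in `P`
(`V₀ ∩ P ≤ H` for an open subgroup `V₀`), `⁅H, G⁆ ≤ A` (elements of `H` are central modulo `A`),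
`⁅H,H⁆ ≤ A` and `xⁿ ∈ A` for `x ∈ H` (`n ≠ 0`).  Then for every `r ∈ P` there is a finite set
`F ⊆ P` such that every conjugate `w r w⁻¹` lies in `f · A` for some `f ∈ F`.
[cite: DDMSAnalyticProP1999, §1.2] -/
theorem exists_finset_conj_subset_mul (P H A : Subgroup G) [hPn : P.Normal] [hHn : H.Normal]
    [hAn : A.Normal] (hAH : A ≤ H) (hHP : H ≤ P) (hAc : IsClosed (A : Set G))
    (V₀ : Subgroup G) (hV₀ : IsOpen (V₀ : Set G)) (hV₀H : V₀ ⊓ P ≤ H)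
    (hGH : ∀ w : G, ∀ x ∈ H, ⁅w, x⁆ ∈ A) {n : ℕ} (hn : n ≠ 0) (hpow : ∀ x ∈ H, x ^ n ∈ A)
    (hfg : ∃ S : Finset G, Dense ((Subgroup.closure (S : Set G) : Subgroup G) : Set G))
    (r : G) (hr : r ∈ P) :
    ∃ F : Finset G, (↑F : Set G) ⊆ P ∧ ∀ w : G, ∃ f ∈ F, f⁻¹ * (w * r * w⁻¹) ∈ A := by
  classical
  have hcommH : ∀ x ∈ H, ∀ y ∈ H, ⁅x, y⁆ ∈ A := fun x _ y hy => hGH x y hy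
  -- the stabiliser `U₀ = {w | ⁅w, r⁆ ∈ H}`
  let U₀ : Subgroup G :=
    { carrier := {w | ⁅w, r⁆ ∈ H}
      mul_mem' := fun {a b} ha hb => by
        change ⁅a * b, r⁆ ∈ H
        rw [commutatorElement_mul_left_eq_conj_mul]
        exact H.mul_mem (hHn.conj_mem _ hb a) ha
      one_mem' := by simp [H.one_mem]
      inv_mem' := fun {a} ha => by
        change ⁅a⁻¹, r⁆ ∈ H
        rw [commutatorElement_inv_left, ← commutatorElement_inv]
        have := hHn.conj_mem _ (H.inv_mem ha) a⁻¹
        simpa using this }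
  have hcont : Continuous fun w : G => ⁅w, r⁆ := by
    simp only [commutatorElement_def]
    exact ((continuous_id.mul continuous_const).mul continuous_inv).mul continuous_const
  have hU₀o : IsOpen (U₀ : Set G) := by
    apply Subgroup.isOpen_of_mem_nhds (g := 1)
    refine Filter.mem_of_superset ((hV₀.preimage hcont).mem_nhds (by simp [V₀.one_mem])) ?_
    intro w hw
    have hwP : ⁅w, r⁆ ∈ P := by
      rw [commutatorElement_def]
      have : w * r * w⁻¹ * r⁻¹ = (w * r * w⁻¹) * r⁻¹ := rfl
      rw [this]; exact P.mul_mem (hPn.conj_mem _ hr w) (P.inv_mem hr)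
    exact hV₀H ⟨hw, hwP⟩
  -- topological generators of `U₀`
  obtain ⟨T₀, hT₀⟩ := exists_finset_dense_closure_of_isOpen hfg U₀ hU₀o
  -- the subgroup `B = ⟨⁅w, r⁆ : w ∈ T₀⟩ ⊔ A ≤ H`, of finite index over `A`, hence closed
  let FT : Finset G := T₀.image fun w => ⁅((w : U₀) : G), r⁆
  set B : Subgroup G := Subgroup.closure (FT : Set G) ⊔ A with hB
  have hFTH : (FT : Set G) ⊆ H := by
    intro x hx
    obtain ⟨w, -, rfl⟩ := Finset.mem_image.mp (Finset.mem_coe.mp hx)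
    exact w.2
  have hBH : B ≤ H := sup_le ((Subgroup.closure_le _).mpr hFTH) hAH
  haveI hBfi : (A.subgroupOf B).FiniteIndex := by
    refine finiteIndex_subgroupOf_closure_sup A H hcommH hn hpow FT ?_
    have : H.subgroupOf (Subgroup.closure (FT : Set G) ⊔ A) = ⊤ :=
      Subgroup.subgroupOf_eq_top.mpr hBH
    rw [this]; infer_instance
  have hBc : IsClosed (B : Set G) := isClosed_of_finiteIndex_subgroupOf A B le_sup_right hAc
  -- `S = {w | ⁅w, r⁆ ∈ B}` is a closed subgroup containing `T₀`, hence `U₀`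
  let S : Subgroup G :=
    { carrier := {w | ⁅w, r⁆ ∈ B}
      mul_mem' := fun {a b} ha hb => by
        change ⁅a * b, r⁆ ∈ B
        rw [commutatorElement_mul_left_eq_conj_mul]
        have h1 : a * ⁅b, r⁆ * a⁻¹ = ⁅a, ⁅b, r⁆⁆ * ⁅b, r⁆ := by
          simp only [commutatorElement_def]; group
        rw [h1]
        exact B.mul_mem (B.mul_mem (Subgroup.mem_sup_right (hGH a _ (hBH hb))) hb) ha
      one_mem' := by simp [B.one_mem]
      inv_mem' := fun {a} ha => by
        change ⁅a⁻¹, r⁆ ∈ B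
        have h1 : ⁅a⁻¹, r⁆ = ⁅a⁻¹, ⁅a, r⁆⁻¹⁆ * ⁅a, r⁆⁻¹ := by
          simp only [commutatorElement_def]; group
        rw [h1]
        exact B.mul_mem (Subgroup.mem_sup_right (hGH a⁻¹ _ (H.inv_mem (hBH ha)))) (B.inv_mem ha) }
  have hSc : IsClosed (S : Set G) := hBc.preimage hcont
  have hU₀S : ∀ u : G, u ∈ U₀ → ⁅u, r⁆ ∈ B := by
    intro u hu
    -- `⟨u, hu⟩` lies in the closure of `closure T₀` inside `U₀`
    have h1 : (⟨u, hu⟩ : U₀) ∈ closure ((Subgroup.closure (T₀ : Set U₀) : Subgroup U₀) : Set U₀) :=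
      hT₀ ⟨u, hu⟩
    rw [closure_subtype] at h1
    have h2 : Subtype.val '' ((Subgroup.closure (T₀ : Set U₀) : Subgroup U₀) : Set U₀) ⊆ (S : Set G) := by
      rintro _ ⟨w, hw, rfl⟩
      change (w : G) ∈ S
      have : (Subgroup.closure (T₀ : Set U₀)).map U₀.subtype ≤ S := by
        rw [MonoidHom.map_closure, Subgroup.closure_le]
        rintro _ ⟨v, hv, rfl⟩
        change ⁅(v : G), r⁆ ∈ B
        exact Subgroup.mem_sup_left (Subgroup.subset_closure (Finset.mem_image.mpr ⟨v, hv, rfl⟩))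
      exact this ⟨w, hw, rfl⟩
    have h3 : (u : G) ∈ closure (S : Set G) := closure_mono h2 h1
    rw [hSc.closure_eq] at h3
    exact h3
  -- coset representatives of `A` in `B` and of `U₀` in `G`
  haveI : Finite (G ⧸ U₀) := Subgroup.quotient_finite_of_isOpen U₀ hU₀o
  haveI : Finite (B ⧸ A.subgroupOf B) := Subgroup.finite_quotient_of_finiteIndex
  haveI : Fintype (G ⧸ U₀) := Fintype.ofFinite _
  haveI : Fintype (B ⧸ A.subgroupOf B) := Fintype.ofFinite _
  let F : Finset G := (Finset.univ : Finset ((G ⧸ U₀) × (B ⧸ A.subgroupOf B))).image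
    fun q => q.1.out * (((q.2.out : B) : G) * r) * q.1.out⁻¹
  refine ⟨F, ?_, fun w => ?_⟩
  · intro f hf
    obtain ⟨q, -, rfl⟩ := Finset.mem_image.mp (Finset.mem_coe.mp hf)
    exact hPn.conj_mem _ (P.mul_mem (hHP (hBH (q.2.out).2)) hr) _
  · -- `w = w₀ u` with `w₀` the representative of `w U₀`, `u ∈ U₀`
    obtain ⟨u, hu⟩ := QuotientGroup.mk_out_eq_mul U₀ w
    set w₀ : G := (QuotientGroup.mk w : G ⧸ U₀).out with hw₀
    have hw : w = w₀ * (u : G)⁻¹ := by rw [hu]; group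
    -- `u⁻¹ r u = b r` with `b = ⁅u⁻¹, r⁆ ∈ B`, and `b = d a` with `d` the representative of `b A`
    have hb : ⁅((u : G))⁻¹, r⁆ ∈ B := hU₀S _ (U₀.inv_mem u.2)
    obtain ⟨a, ha⟩ := QuotientGroup.mk_out_eq_mul (A.subgroupOf B) (⟨_, hb⟩ : B)
    set d : B := (QuotientGroup.mk (⟨_, hb⟩ : B) : B ⧸ A.subgroupOf B).out with hd
    refine ⟨w₀ * ((d : G) * r) * w₀⁻¹, Finset.mem_image.mpr
      ⟨(QuotientGroup.mk w, QuotientGroup.mk (⟨_, hb⟩ : B)), Finset.mem_univ _, rfl⟩, ?_⟩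
    have hda : (d : G) = ⁅((u : G))⁻¹, r⁆ * ((a : B) : G) := by
      have := congrArg (fun x : B => (x : G)) ha
      simpa using this
    have haA : ((a : B) : G) ∈ A := Subgroup.mem_subgroupOf.mp a.2
    -- compute
    have key : (w₀ * ((d : G) * r) * w₀⁻¹)⁻¹ * (w * r * w⁻¹) =
        w₀ * (r⁻¹ * ((a : B) : G)⁻¹ * r) * w₀⁻¹ := by
      rw [hw, hda]; simp only [commutatorElement_def]; group
    rw [key]
    exact hAn.conj_mem _ (hAn.conj_mem' _ (A.inv_mem haA) r) _

/-! ### The openness theorem -/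

omit [TopologicalSpace G] [IsTopologicalGroup G] [CompactSpace G] [T2Space G]
  [TotallyDisconnectedSpace G] in
/-- The subgroup generated by the `n`-th powers of a normal subgroup is normal. [folklore] -/
private theorem normal_closure_pow (H : Subgroup G) [hH : H.Normal] (n : ℕ) :
    (Subgroup.closure {y | ∃ x ∈ H, x ^ n = y}).Normal := by
  refine ⟨fun a ha g => ?_⟩
  induction ha using Subgroup.closure_induction with
  | mem x hx =>
    obtain ⟨y, hy, rfl⟩ := hx
    refine Subgroup.subset_closure ⟨g * y * g⁻¹, hH.conj_mem _ hy g, ?_⟩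
    rw [conj_pow]
  | one => simp
  | mul x y _ _ hx hy =>
    have : g * (x * y) * g⁻¹ = (g * x * g⁻¹) * (g * y * g⁻¹) := by group
    rw [this]; exact Subgroup.mul_mem _ hx hy
  | inv x _ hx =>
    have : g * x⁻¹ * g⁻¹ = (g * x * g⁻¹)⁻¹ := by group
    rw [this]; exact Subgroup.inv_mem _ hx

/-- **Openness of `⁅H, G⁆ · Hⁿ` (N–S-free).**  In the setting of the module docstring (`P` closed), for
every normal `H ≤ P` open in `P` and every `n ≠ 0` there is an open subgroup `V` with
`V ∩ H ≤ ⁅H, G⁆ ⊔ ⟨xⁿ : x ∈ H⟩` — hypothesis `(c'')` of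
`Literature.GroupTheory.isOpen_of_finiteIndex_of_proP_normal` at `(P', U) = (H, G)`.
[cite: NikolovSegal2007, Theorem 1.3] -/
theorem exists_isOpen_inf_le_commutator_sup_pow_of_profinite {p : ℕ} [Fact p.Prime]
    (P : Subgroup G) [hPn : P.Normal] (hPc : IsClosed (P : Set G))
    (hPp : ∀ x ∈ P, ∀ U ∈ nhds (1 : G), ∃ k : ℕ, x ^ p ^ k ∈ U) (t s : G)
    (hte : ∀ W : OpenNormalSubgroup G, ∃ e : ℕ, p.Coprime e ∧ t ^ e ∈ (P ⊔ (W : Subgroup G)))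
    (ht_conj : ∀ w : G, w * t * w⁻¹ ∈ closure ((Subgroup.zpowers t ⊔ P : Subgroup G) : Set G))
    (hs_conj : ∀ w : G, w * s * w⁻¹ * s⁻¹ ∈ closure ((Subgroup.zpowers t ⊔ P : Subgroup G) : Set G))
    {d : ℕ} (g : Fin d → G) (hgen : Dense ((Subgroup.closure (Set.range g) : Subgroup G) : Set G))
    (hslots : ∀ j, g j ∈ P ∨ g j = t ∨ g j = s) (jt js : Fin d) (hjt : g jt = t) (hjs : g js = s)
    (hPgen : (P : Set G) ⊆
      closure ((Subgroup.normalClosure {x | x ∈ Set.range g ∧ x ∈ P} : Subgroup G) : Set G))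
    (H : Subgroup G) [hHn : H.Normal] (hHP : H ≤ P)
    (hHo : ∃ V₀ : Subgroup G, IsOpen (V₀ : Set G) ∧ V₀ ⊓ P ≤ H) {n : ℕ} (hn : n ≠ 0) :
    ∃ V : Subgroup G, IsOpen (V : Set G) ∧
      V ⊓ H ≤ ⁅H, (⊤ : Subgroup G)⁆ ⊔ Subgroup.closure {y | ∃ x ∈ H, x ^ n = y} := by
  classical
  obtain ⟨V₀, hV₀, hV₀H⟩ := hHo
  -- `H` has finite index in `P` and is closed
  haveI : Finite (G ⧸ V₀) := Subgroup.quotient_finite_of_isOpen V₀ hV₀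
  haveI : V₀.FiniteIndex := Subgroup.finiteIndex_of_finite_quotient
  have hV₀PH : (V₀ ⊓ P).subgroupOf H = V₀.subgroupOf H := by
    ext x; simp only [Subgroup.mem_subgroupOf, Subgroup.mem_inf]
    exact ⟨fun h => h.1, fun h => ⟨h, hHP x.2⟩⟩
  haveI : ((V₀ ⊓ P).subgroupOf H).FiniteIndex := by rw [hV₀PH]; infer_instance
  have hHc : IsClosed (H : Set G) :=
    isClosed_of_finiteIndex_subgroupOf (V₀ ⊓ P) H hV₀H
      (by rw [Subgroup.coe_inf]; exact (Subgroup.isClosed_of_isOpen V₀ hV₀).inter hPc)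
  haveI : (H.subgroupOf P).FiniteIndex := by
    have h1 : V₀.subgroupOf P ≤ H.subgroupOf P := fun x hx =>
      Subgroup.mem_subgroupOf.mpr (hV₀H ⟨Subgroup.mem_subgroupOf.mp hx, x.2⟩)
    exact Subgroup.finiteIndex_of_le h1
  -- the subgroup `A`
  haveI := normal_closure_pow H n
  set A : Subgroup G := ⁅H, (⊤ : Subgroup G)⁆ ⊔ Subgroup.closure {y | ∃ x ∈ H, x ^ n = y} with hA
  haveI hAn : A.Normal := Subgroup.sup_normal _ _
  have hAc : IsClosed (A : Set G) := isClosed_commutator_sup_pow_of_profinite P hPp t s hte ht_conj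
    hs_conj g hgen hslots jt js hjt hjs hPgen H hHc hHP n
  have hAH : A ≤ H := sup_le (Subgroup.commutator_le_left H ⊤)
    ((Subgroup.closure_le _).mpr (by rintro _ ⟨x, hx, rfl⟩; exact H.pow_mem hx n))
  have hGH : ∀ w : G, ∀ x ∈ H, ⁅w, x⁆ ∈ A := fun w x hx => by
    rw [← commutatorElement_inv]
    exact A.inv_mem (Subgroup.mem_sup_left (Subgroup.commutator_mem_commutator hx (Subgroup.mem_top w)))
  have hpowA : ∀ x ∈ H, x ^ n ∈ A := fun x hx =>
    Subgroup.mem_sup_right (Subgroup.subset_closure ⟨x, hx, rfl⟩)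
  have hcommH : ∀ x ∈ H, ∀ y ∈ H, ⁅x, y⁆ ∈ A := fun x _ y hy => hGH x y hy
  have hfg : ∃ S : Finset G, Dense ((Subgroup.closure (S : Set G) : Subgroup G) : Set G) :=
    ⟨Finset.univ.image g, by simpa using hgen⟩
  -- finitely many cosets of `A` meet the conjugacy class of each `P`-slot
  have hslot : ∀ j, ∃ F : Finset G, (↑F : Set G) ⊆ P ∧
      (g j ∈ P → ∀ w : G, ∃ f ∈ F, f⁻¹ * (w * g j * w⁻¹) ∈ A) := by
    intro j
    by_cases hj : g j ∈ P
    · obtain ⟨F, hFP, hF⟩ := exists_finset_conj_subset_mul P H A hAH hHP hAc V₀ hV₀ hV₀H hGH hn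
        hpowA hfg (g j) hj
      exact ⟨F, hFP, fun _ => hF⟩
    · exact ⟨∅, by simp, fun h => absurd h hj⟩
  choose Fs hFsP hFs using hslot
  let F : Finset G := Finset.univ.biUnion Fs
  have hFP : (↑F : Set G) ⊆ P := by
    intro x hx
    obtain ⟨j, -, hxj⟩ := Finset.mem_biUnion.mp (Finset.mem_coe.mp hx)
    exact hFsP j hxj
  -- `B' = ⟨F⟩ ⊔ A` contains the normal closure of the `P`-slots, is of finite index over `A`, closed
  set B' : Subgroup G := Subgroup.closure (F : Set G) ⊔ A with hB'
  have hB'P : B' ≤ P := sup_le ((Subgroup.closure_le _).mpr hFP) (hAH.trans hHP)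
  have hNC : Subgroup.normalClosure {x | x ∈ Set.range g ∧ x ∈ P} ≤ B' := by
    change Subgroup.closure (Group.conjugatesOfSet _) ≤ B'
    rw [Subgroup.closure_le]
    intro y hy
    obtain ⟨x, ⟨⟨j, rfl⟩, hxP⟩, hconj⟩ := Group.mem_conjugatesOfSet_iff.mp hy
    obtain ⟨c, rfl⟩ := isConj_iff.mp hconj
    obtain ⟨f, hf, hfa⟩ := hFs j hxP c
    have : c * g j * c⁻¹ = f * (f⁻¹ * (c * g j * c⁻¹)) := by group
    rw [this]
    exact B'.mul_mem (Subgroup.mem_sup_left (Subgroup.subset_closure (Finset.mem_biUnion.mpr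
      ⟨j, Finset.mem_univ _, hf⟩))) (Subgroup.mem_sup_right hfa)
  haveI hB'fi : (A.subgroupOf B').FiniteIndex := by
    refine finiteIndex_subgroupOf_closure_sup A H hcommH hn hpowA F ?_
    -- `H ∩ B'` has finite index in `B'` since `B' ≤ P` and `[P : H] < ∞`
    refine ⟨fun h0 => ?_⟩
    have h1 : H.relIndex P = 0 :=
      Subgroup.relIndex_eq_zero_of_le_right hB'P h0
    exact (Subgroup.FiniteIndex.index_ne_zero (H := H.subgroupOf P)) h1
  have hB'c : IsClosed (B' : Set G) := isClosed_of_finiteIndex_subgroupOf A B' le_sup_right hAc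
  -- hence `P ≤ B'` and `A` has finite index in `H`
  have hPB' : P ≤ B' := fun x hx => by
    have h1 := hPgen hx
    have h2 : closure ((Subgroup.normalClosure {x | x ∈ Set.range g ∧ x ∈ P} : Subgroup G) : Set G)
        ⊆ (B' : Set G) := by
      rw [← hB'c.closure_eq]; exact closure_mono (fun y hy => hNC hy)
    exact h2 h1
  haveI hAHfi : (A.subgroupOf H).FiniteIndex := by
    have hHB' : H ≤ B' := hHP.trans hPB'
    have : (A.subgroupOf B').relIndex (H.subgroupOf B') = A.relIndex H :=
      Subgroup.relIndex_subgroupOf hHB'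
    refine ⟨fun h0 => ?_⟩
    have h1 : (A.subgroupOf B').relIndex (H.subgroupOf B') = 0 := by
      rw [this]; exact h0
    exact (Subgroup.FiniteIndex.index_ne_zero
      (H := (A.subgroupOf B').subgroupOf (H.subgroupOf B'))) h1
  -- `A ∩ H` is closed of finite index in `H`, hence open in `H`
  have hAHc : IsClosed ((A.subgroupOf H : Subgroup H) : Set H) :=
    hAc.preimage continuous_subtype_val
  have hAHo : IsOpen ((A.subgroupOf H : Subgroup H) : Set H) :=
    Subgroup.isOpen_of_isClosed_of_finiteIndex _ hAHc
  obtain ⟨O, hO, hOA⟩ := isOpen_induced_iff.mp hAHo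
  have h1O : (1 : G) ∈ O := by
    have : (1 : H) ∈ Subtype.val ⁻¹' O := by rw [hOA]; exact Subgroup.one_mem _
    exact this
  obtain ⟨W, hW⟩ := ProfiniteGrp.exist_openNormalSubgroup_sub_open_nhds_of_one hO h1O
  refine ⟨W, W.isOpen, ?_⟩
  rintro x ⟨hxW, hxH⟩
  have : (⟨x, hxH⟩ : H) ∈ Subtype.val ⁻¹' O := hW hxW
  rw [hOA] at this
  exact Subgroup.mem_subgroupOf.mp this

end Literature.GroupTheory
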